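import Summits.ResolutionOfSingularities.ResolutionOfSingularities.Theorems.WallFrames10
import Summits.ResolutionOfSingularities.ResolutionOfSingularities.Theorems.NearCutCompanion3
import Summits.ResolutionOfSingularities.ResolutionOfSingularities.Theorems.NearCutWalls2
import Summits.ResolutionOfSingularities.ResolutionOfSingularities.Theorems.ProximityCutArcLaw
import Summits.ResolutionOfSingularities.ResolutionOfSingularities.Theorems.MaxContactCutBoundaryLedger
import Summits.ResolutionOfSingularities.ResolutionOfSingularities.Theorems.MaxContactCutWallCut
import Summits.ResolutionOfSingularities.ResolutionOfSingularities.Theorems.PlanarGhostDescent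
import Literature.AlgebraicGeometry.Resolution.PointBlowupIFPGiraud
import Literature.AlgebraicGeometry.Resolution.AdicNoetherian
import HarnessLib

/-!
# WallFrames (11/17) — Kollár's wall descent in a polynomial frame; sections: TransversalWalk (cont.), LineageWalk, JetTransport

Verbatim slice of the farm-checked monolith `WallFrames.lean` of cell `decomp-res`, seat `decomp-res-lens-5`, g35
(sha256 7405a21d81d102a4…, monolith lines 2618–2878); one namespace `Summit.ResolutionOfSingularities.ResolutionOfSingularities.Theorems.WallFrames` across the
slices, imports chained.  The monolith's module docstring (laws W1–W7, mechanism, novelty, honest placement) is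
reproduced in slice 1; the main theorem `balancedWallPort_holds : WallCut.BalancedWallPort` (hypothesis-free) and the
host-route corollary `ecBalancedWallPort_holds` (aside item 27368 of route MaxContactCut) are in slice 16/17.
-/

open MvPolynomial Finset
open scoped BigOperators
open Literature.AlgebraicGeometry.Resolution
open Literature.AlgebraicGeometry.Resolution.Hauser2010
open Literature.AlgebraicGeometry.Resolution.PointBlowup
open Literature.AlgebraicGeometry.Resolution.HauserPerlega2024

namespace Summit.ResolutionOfSingularities.ResolutionOfSingularities.Theorems.WallFrames

variable {σ : Type*} [Fintype σ] [DecidableEq σ] {K : Type*} [Field K]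

section TransversalWalk

variable {L : Type} [Field L] [DecidableEq L]

/-- **TRANSVERSALITY ALONG A δ-BALANCED RECURRENT TAIL (NEXT-g36 §2).**  On the companion chain `G_n` of a δ-balanced
plateau (`ord G_n = s`, `in_s G_n = c_n ℓ_n^s`), if `StaysOnNewest` recurs then the directrix is transverse to the free
letter at every stage: `coeff_{y_{f_n}} ℓ_n ≠ 0`. [new] -/
theorem transversal {q : ℕ} {s₀ : State (Fin 3) L} (hroot : TightDefectClasses.IsRoot q s₀)
    (W : TightDefectClasses.ForcedWalk q s₀) (N s : ℕ) (hs : s ≠ 0)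
    (hshade : ∀ t, N ≤ t → (W.st t).shade = (s : ℕ∞))
    (hbig : ∀ t, N ≤ t → ordZero (W.st t).F ≠ (q : ℕ∞))
    (hbal : ∀ t, N ≤ t → (W.st t).r.degree + 2 * s = 2 * q ∧
      ∃ x, (W.st t).r x = 0 ∧ ∀ y, y ≠ x → (W.st t).r y + s = q)
    (hGs : ∀ n, ordZero (NearCut.companion W N s n) = (s : ℕ∞))
    (c : ℕ → L) (ℓ : ℕ → MvPolynomial (Fin 3) L) (hc : ∀ n, c n ≠ 0) (hℓ1 : ∀ n, (ℓ n).IsHomogeneous 1)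
    (hℓ0 : ∀ n, ℓ n ≠ 0) (hin : ∀ n, homogeneousComponent s (NearCut.companion W N s n) = C (c n) * ℓ n ^ s)
    (f : ℕ → Fin 3) (hf : ∀ n, (W.st (N + n)).r (f n) = 0)
    (hrec : ∀ M : ℕ, ∃ t, M ≤ t ∧ ProximityCut.StaysOnNewest W t) :
    ∀ n, coeff (Finsupp.single (f n) 1) (ℓ n) ≠ 0 := by
  classical
  have hsq : s < q := NearCut.lt_of_balanced hroot W N s (hshade N le_rfl) (hbig N le_rfl) (hbal N le_rfl).1
  have hδ : q - s ≠ 0 := by omega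
  -- the anatomy of move `N + m`
  have hanat : ∀ m, ∃ k o : Fin 3, k ≠ W.j (N + m) ∧ o ≠ W.j (N + m) ∧ o ≠ k ∧
      (∀ i, i = W.j (N + m) ∨ i = k ∨ i = o) ∧
      (W.st (N + m)).r k = q - s ∧ W.b (N + m) k = 0 ∧ (W.st (N + m + 1)).r k = q - s ∧
      (W.st (N + m + 1)).r (W.j (N + m)) = q - s ∧ (W.st (N + m + 1)).r o = 0 ∧
      (∀ i, i ≠ o → W.b (N + m) i = 0) ∧
      (((W.st (N + m)).r (W.j (N + m)) = q - s ∧ (W.st (N + m)).r o = 0) ∨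
       ((W.st (N + m)).r (W.j (N + m)) = 0 ∧ (W.st (N + m)).r o = q - s ∧ W.b (N + m) o ≠ 0)) := fun m =>
    move_anatomy hroot W (N + m) s (hshade _ (by omega)) (hbig _ (by omega)) (hbal _ (by omega))
      (hbal _ (by omega))
  -- constant terms vanish along the chain
  have hG0 : ∀ n, constantCoeff (NearCut.companion W N s n) = 0 := fun n => by
    rw [constantCoeff_eq]
    apply coeff_eq_zero_of_degree_lt_ordZero
    rw [hGs n, map_zero]
    exact_mod_cast Nat.pos_of_ne_zero hs
  have hGle : ∀ n, (s : ℕ∞) ≤ ordZero (NearCut.companion W N s n) := fun n => (hGs n).ge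
  -- AXIS at stage `m`: zero free coefficient ⇒ `ℓ_m = α y_k` for the kept wall `k` of move `N + m`
  have haxis : ∀ m (k o : Fin 3), k ≠ W.j (N + m) → o ≠ W.j (N + m) → (∀ i, i = W.j (N + m) ∨ i = k ∨ i = o) →
      (W.st (N + m)).r k = q - s → W.b (N + m) k = 0 →
      (((W.st (N + m)).r (W.j (N + m)) = q - s ∧ (W.st (N + m)).r o = 0) ∨
       ((W.st (N + m)).r (W.j (N + m)) = 0 ∧ (W.st (N + m)).r o = q - s ∧ W.b (N + m) o ≠ 0)) →
      coeff (Finsupp.single (f m) 1) (ℓ m) = 0 →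
      (∀ i, i ≠ k → coeff (Finsupp.single i 1) (ℓ m) = 0) ∧ coeff (Finsupp.single k 1) (ℓ m) ≠ 0 := by
    intro m k o hkj hoj hcases hrk hbk hdich hfm
    have hfree : coeff (Finsupp.single o 1) (ℓ m) = 0 ∨
        (coeff (Finsupp.single (W.j (N + m)) 1) (ℓ m) = 0 ∧ W.b (N + m) o ≠ 0) := by
      rcases hdich with ⟨hrj, hro⟩ | ⟨hrj, hro, hbo⟩
      · left
        have hfo : f m = o := by
          rcases hcases (f m) with h | h | h
          · exfalso; have := hf m; rw [h, hrj] at this; exact hδ this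
          · exfalso; have := hf m; rw [h, hrk] at this; exact hδ this
          · exact h
        rw [← hfo]; exact hfm
      · right
        have hfj : f m = W.j (N + m) := by
          rcases hcases (f m) with h | h | h
          · exact h
          · exfalso; have := hf m; rw [h, hrk] at this; exact hδ this
          · exfalso; have := hf m; rw [h, hro] at this; exact hδ this
        exact ⟨by rw [← hfj]; exact hfm, hbo⟩
    exact axis_of_coeff_eq_zero hkj hoj hcases (W.onExc (N + m)) hbk hs (hc m) (hℓ1 m) (hℓ0 m) (hGle m)
      (hin m) (NearCut.companion_succ W N s m) (hG0 (m + 1)) hfree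
  -- PROPAGATION: `ℓ_m = α y_k`, `b_k = 0`, `k ≠ j` ⇒ at stage `m+1` the coefficients off `{j, k}` vanish and `coeff_k ≠ 0`
  have hprop : ∀ m (k : Fin 3), k ≠ W.j (N + m) → W.b (N + m) k = 0 →
      (∀ i, i ≠ k → coeff (Finsupp.single i 1) (ℓ m) = 0) → coeff (Finsupp.single k 1) (ℓ m) ≠ 0 →
      (∀ o', o' ≠ W.j (N + m) → o' ≠ k → coeff (Finsupp.single o' 1) (ℓ (m + 1)) = 0) ∧
        coeff (Finsupp.single k 1) (ℓ (m + 1)) ≠ 0 := by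
    intro m k hkj hbk hzero hαk
    obtain ⟨α, hα⟩ : ∃ α, coeff (Finsupp.single k 1) (ℓ m) = α := ⟨_, rfl⟩
    have hℓeq : ℓ m = C α * X k := by rw [← hα]; exact eq_C_mul_X_of_coeff (hℓ1 m) hzero
    have hin' : homogeneousComponent s (NearCut.companion W N s m) = C (c m * α ^ s) * X k ^ s := by
      rw [hin m, hℓeq, mul_pow, ← C_pow, ← mul_assoc, ← C_mul]
    have hcα : c m * α ^ s ≠ 0 := mul_ne_zero (hc m) (pow_ne_zero _ (hα ▸ hαk))
    have hsub := translate_chartTransform_sub_mem_span (Ne.symm hkj) (W.onExc (N + m)) hbk (hGle m) hin'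
    rw [← NearCut.companion_succ W N s m] at hsub
    obtain ⟨L', hL'⟩ := homogeneousComponent_eq_add_of_sub_mem_span (Nat.pos_of_ne_zero hs) hsub
    rw [hin (m + 1)] at hL'
    exact transversal_of_congr (Ne.symm hkj) hs hcα (hc (m + 1)) (hℓ1 (m + 1)) hL'
  -- the contradiction
  intro n₀ hn₀
  obtain ⟨k₀, o₀, hk₀j, ho₀j, -, hcases₀, hrk₀, hbk₀, -, -, -, -, hdich₀⟩ := hanat n₀
  have hbase := haxis n₀ k₀ o₀ hk₀j ho₀j hcases₀ hrk₀ hbk₀ hdich₀ hn₀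
  -- CLAIM by induction: free coefficient zero, `k₀` a wall, `coeff_{k₀} ≠ 0`
  have hclaim : ∀ m, n₀ ≤ m → coeff (Finsupp.single (f m) 1) (ℓ m) = 0 ∧ (W.st (N + m)).r k₀ = q - s ∧
      coeff (Finsupp.single k₀ 1) (ℓ m) ≠ 0 := by
    intro m hm
    induction m, hm using Nat.le_induction with
    | base => exact ⟨hn₀, hrk₀, hbase.2⟩
    | succ m hm ih =>
      obtain ⟨hfm, hrk₀m, hαk₀⟩ := ih
      obtain ⟨k, o, hkj, hoj, hok, hcases, hrk, hbk, hrk', hrj', hro', hb, hdich⟩ := hanat m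
      have hax := haxis m k o hkj hoj hcases hrk hbk hdich hfm
      have hkk₀ : k = k₀ := by
        by_contra h
        exact hαk₀ (hax.1 k₀ (Ne.symm h))
      subst hkk₀
      have hpr := hprop m k hkj hbk hax.1 hax.2
      refine ⟨hpr.1 (f (m + 1)) ?_ ?_, hrk', hpr.2⟩
      · intro h; have := hf (m + 1); rw [h] at this
        have h' : (W.st (N + m + 1)).r (W.j (N + m)) = 0 := this
        rw [hrj'] at h'; exact hδ h'
      · intro h; have := hf (m + 1); rw [h] at this
        have h' : (W.st (N + m + 1)).r k = 0 := this
        rw [hrk'] at h'; exact hδ h'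
  -- a `StaysOnNewest` move beyond `N + n₀`
  obtain ⟨t, ht, hstay⟩ := hrec (N + n₀)
  obtain ⟨m, rfl⟩ : ∃ m, t = N + m := ⟨t - N, by omega⟩
  have hm : n₀ ≤ m := by omega
  obtain ⟨k, o, hkj, hoj, hok, hcases, hrk, hbk, hrk', hrj', hro', hb, hdich⟩ := hanat m
  obtain ⟨k', o', hk'j, ho'j, ho'k', hcases', hrk'', hbk', -, -, -, -, hdich'⟩ := hanat (m + 1)
  -- `k = k₀` and `k' = k₀`
  have hax := haxis m k o hkj hoj hcases hrk hbk hdich (hclaim m hm).1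
  have hkk₀ : k = k₀ := by
    by_contra h; exact (hclaim m hm).2.2 (hax.1 k₀ (Ne.symm h))
  have hax' := haxis (m + 1) k' o' hk'j ho'j hcases' hrk'' hbk' hdich' (hclaim (m + 1) (by omega)).1
  have hk'k₀ : k' = k₀ := by
    by_contra h; exact (hclaim (m + 1) (by omega)).2.2 (hax'.1 k₀ (Ne.symm h))
  -- but `StaysOnNewest` forces `k' = j_{N+m}`
  have hsw := lost_of_staysOnNewest W (N + m) hδ hkj hcases hrj' hro' ho'k' hcases' hrk'' hdich' hstay
  exact hkj (hkk₀.trans (hk'k₀.symm.trans hsw.1))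

end TransversalWalk

/-! ## §17 THE TRANSPORTED LINEAGE of a δ-balanced tame tail (NEXT-g36 §3 (L1)–(L3), PROVED)

`h_0 := D^{((s−1)e_{f_0})} G_0`, `h_{n+1} := translate b_{N+n} (cT_1^{j_{N+n}} h_n)`: a max-contact element at every stage
(`h_n ∈ hasseSpan (s−1) G_n`, Giraud), vanishing at the point, with linear part `μ_n ℓ_n`, `μ_n ≠ 0`, and NON-ZERO
coefficient on the free letter — so `exists_jet` applies at every stage in the free letter (the frame never degenerates). -/

section LineageWalk

variable {L : Type} [Field L] [DecidableEq L]

/-- The transported Hasse lineage of the companion chain. DEFINITION (data, not a statement). -/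
noncomputable def lineage {q : ℕ} {s₀ : State (Fin 3) L} (W : TightDefectClasses.ForcedWalk q s₀) (N s : ℕ)
    (f₀ : Fin 3) : ℕ → MvPolynomial (Fin 3) L
  | 0 => hasseDeriv L (Finsupp.single f₀ (s - 1)) (NearCut.companion W N s 0)
  | n + 1 => PointBlowup.translate (W.b (N + n)) (chartTransform 1 (W.j (N + n)) (lineage W N s f₀ n))

/-- `lineage_zero`: WallFrames (lens-5 g35) computation rule; docstring added by the writer (lint.docstring) [folklore] -/
theorem lineage_zero {q : ℕ} {s₀ : State (Fin 3) L} (W : TightDefectClasses.ForcedWalk q s₀) (N s : ℕ) (f₀ : Fin 3) :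
    lineage W N s f₀ 0 = hasseDeriv L (Finsupp.single f₀ (s - 1)) (NearCut.companion W N s 0) := rfl

/-- `lineage_succ`: WallFrames (lens-5 g35) computation rule; docstring added by the writer (lint.docstring) [folklore] -/
theorem lineage_succ {q : ℕ} {s₀ : State (Fin 3) L} (W : TightDefectClasses.ForcedWalk q s₀) (N s : ℕ) (f₀ : Fin 3)
    (n : ℕ) : lineage W N s f₀ (n + 1) =
      PointBlowup.translate (W.b (N + n)) (chartTransform 1 (W.j (N + n)) (lineage W N s f₀ n)) := rfl

/-- **THE LINEAGE FACTS (L1)–(L3).**  Along a δ-balanced TAME (`(s : L) ≠ 0`) tail whose directrix is transverse to the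
free letter at every stage (`transversal`), the transported lineage `h_n` is a max-contact element of `G_n`, vanishes at
the point, has linear part `μ_n ℓ_n` with `μ_n ≠ 0`, and `coeff_{y_{f_n}} h_n ≠ 0`. [new] -/
theorem lineage_facts {q : ℕ} {s₀ : State (Fin 3) L} (hroot : TightDefectClasses.IsRoot q s₀)
    (W : TightDefectClasses.ForcedWalk q s₀) (N s : ℕ) (hs : s ≠ 0) (hsL : (s : L) ≠ 0)
    (hshade : ∀ t, N ≤ t → (W.st t).shade = (s : ℕ∞))
    (hbig : ∀ t, N ≤ t → ordZero (W.st t).F ≠ (q : ℕ∞))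
    (hbal : ∀ t, N ≤ t → (W.st t).r.degree + 2 * s = 2 * q ∧
      ∃ x, (W.st t).r x = 0 ∧ ∀ y, y ≠ x → (W.st t).r y + s = q)
    (hGs : ∀ n, ordZero (NearCut.companion W N s n) = (s : ℕ∞))
    (c : ℕ → L) (ℓ : ℕ → MvPolynomial (Fin 3) L) (hc : ∀ n, c n ≠ 0) (hℓ1 : ∀ n, (ℓ n).IsHomogeneous 1)
    (hin : ∀ n, homogeneousComponent s (NearCut.companion W N s n) = C (c n) * ℓ n ^ s)
    (f : ℕ → Fin 3) (hf : ∀ n, (W.st (N + n)).r (f n) = 0)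
    (htrans : ∀ n, coeff (Finsupp.single (f n) 1) (ℓ n) ≠ 0) :
    ∀ n, lineage W N s (f 0) n ∈ hasseSpan (s - 1) (NearCut.companion W N s n) ∧
      constantCoeff (lineage W N s (f 0) n) = 0 ∧
      coeff (Finsupp.single (f n) 1) (lineage W N s (f 0) n) ≠ 0 ∧
      ∃ μ : L, μ ≠ 0 ∧ ∀ i, coeff (Finsupp.single i 1) (lineage W N s (f 0) n) = μ * coeff (Finsupp.single i 1) (ℓ n) := by
  classical
  have hs1 : 1 ≤ s := Nat.pos_of_ne_zero hs
  have hsq : s < q := NearCut.lt_of_balanced hroot W N s (hshade N le_rfl) (hbig N le_rfl) (hbal N le_rfl).1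
  have hδ : q - s ≠ 0 := by omega
  have hanat : ∀ m, ∃ k o : Fin 3, k ≠ W.j (N + m) ∧ o ≠ W.j (N + m) ∧ o ≠ k ∧
      (∀ i, i = W.j (N + m) ∨ i = k ∨ i = o) ∧
      (W.st (N + m)).r k = q - s ∧ W.b (N + m) k = 0 ∧ (W.st (N + m + 1)).r k = q - s ∧
      (W.st (N + m + 1)).r (W.j (N + m)) = q - s ∧ (W.st (N + m + 1)).r o = 0 ∧
      (∀ i, i ≠ o → W.b (N + m) i = 0) ∧
      (((W.st (N + m)).r (W.j (N + m)) = q - s ∧ (W.st (N + m)).r o = 0) ∨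
       ((W.st (N + m)).r (W.j (N + m)) = 0 ∧ (W.st (N + m)).r o = q - s ∧ W.b (N + m) o ≠ 0)) := fun m =>
    move_anatomy hroot W (N + m) s (hshade _ (by omega)) (hbig _ (by omega)) (hbal _ (by omega))
      (hbal _ (by omega))
  have hG0 : ∀ n, constantCoeff (NearCut.companion W N s n) = 0 := fun n => by
    rw [constantCoeff_eq]
    apply coeff_eq_zero_of_degree_lt_ordZero
    rw [hGs n, map_zero]
    exact_mod_cast Nat.pos_of_ne_zero hs
  have hGle : ∀ n, (s : ℕ∞) ≤ ordZero (NearCut.companion W N s n) := fun n => (hGs n).ge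
  have hmem : ∀ n, lineage W N s (f 0) n ∈ hasseSpan (s - 1) (NearCut.companion W N s n) :=
    lineage_mem_hasseSpan hs1 (fun n => NearCut.companion W N s n) (lineage W N s (f 0)) (fun n => W.j (N + n))
      (fun n => W.b (N + n)) hGle (fun n => NearCut.companion_succ W N s n)
      (hasseDeriv_mem_hasseSpan (by rw [Finsupp.degree_single]) _) (fun n => rfl)
  have htan : ∀ n, constantCoeff (lineage W N s (f 0) n) = 0 ∧
      ∃ μ : L, ∀ i, coeff (Finsupp.single i 1) (lineage W N s (f 0) n) = μ * coeff (Finsupp.single i 1) (ℓ n) :=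
    fun n => lineage_tangent hs1 (hℓ1 n) (hGle n) (hin n) (hmem n)
  have hcoef : ∀ n, coeff (Finsupp.single (f n) 1) (lineage W N s (f 0) n) ≠ 0 := by
    intro n
    induction n with
    | zero => exact coeff_single_hasseDeriv_ne_zero (f 0) hs1 (hℓ1 0) (hin 0) hsL (hc 0) (htrans 0)
    | succ n ih =>
      obtain ⟨k, o, hkj, hoj, hok, hcases, hrk, hbk, hrk', hrj', hro', hb, hdich⟩ := hanat n
      have hfo : f (n + 1) = o := by
        rcases hcases (f (n + 1)) with h | h | h
        · exfalso; have h' : (W.st (N + n + 1)).r (f (n + 1)) = 0 := hf (n + 1)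
          rw [h, hrj'] at h'; exact hδ h'
        · exfalso; have h' : (W.st (N + n + 1)).r (f (n + 1)) = 0 := hf (n + 1)
          rw [h, hrk'] at h'; exact hδ h'
        · exact h
      have hpers : coeff (Finsupp.single (f (n + 1)) 1) (lineage W N s (f 0) (n + 1)) =
          coeff (Finsupp.single (f (n + 1)) 1) (lineage W N s (f 0) n) := by
        rw [lineage_succ]
        exact coeff_single_translate_chartTransform_one (by rw [hfo]; exact hoj) (W.onExc (N + n))
          (one_le_ordZero_of_mem_hasseSpan hs1 (hGle n) (hmem n))
      rw [hpers, hfo]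
      obtain ⟨-, μ, hμ⟩ := htan n
      have hμ0 : μ ≠ 0 := by
        intro h; apply ih; rw [hμ, h, zero_mul]
      rw [hμ]
      refine mul_ne_zero hμ0 ?_
      rcases hdich with ⟨hrj, hro⟩ | ⟨hrj, hro, hbo⟩
      · have hfn : f n = o := by
          rcases hcases (f n) with h | h | h
          · exfalso; have h' := hf n; rw [h, hrj] at h'; exact hδ h'
          · exfalso; have h' := hf n; rw [h, hrk] at h'; exact hδ h'
          · exact h
        rw [← hfn]; exact htrans n
      · have hfn : f n = W.j (N + n) := by
          rcases hcases (f n) with h | h | h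
          · exact h
          · exfalso; have h' := hf n; rw [h, hrk] at h'; exact hδ h'
          · exfalso; have h' := hf n; rw [h, hro] at h'; exact hδ h'
        have hnear := nearness_sum (W.j (N + n)) (W.onExc (N + n)) hs (hc n) (hℓ1 n) (hGle n) (hin n)
          (by rw [← NearCut.companion_succ]; exact hG0 (n + 1))
        rw [sum_eq_of_three hkj hoj hok hcases, Function.update_self, Function.update_of_ne hkj,
          Function.update_of_ne hoj, hbk, mul_one, mul_zero, add_zero] at hnear
        intro hαo
        rw [hαo, zero_mul, add_zero, ← hfn] at hnear
        exact htrans n hnear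
  intro n
  refine ⟨hmem n, (htan n).1, hcoef n, ?_⟩
  obtain ⟨-, μ, hμ⟩ := htan n
  exact ⟨μ, fun h => hcoef n (by rw [hμ, h, zero_mul]), hμ⟩

end LineageWalk

/-! ## §18 ONE-STEP JET TRANSPORT (NEXT-g36 §3 (L5), packaged): the frame data after a lost-wall move

Given the frame `h = Q (y_z − ζ) + r` (`r = h|_{y_z := ζ}` of order `≥ D+1`, `Q(0) ≠ 0`) and a lost-wall move (chart `j ≠ z`,
centre `b = b_z e_z` ON the lineage), the transported `h' = translate b (cT_1^j h)` is again in frame form w.r.t. the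
transported jet `ζ' = cT_1^j ζ − b_z` (z-free, order ≥ 1), with unit `translate b (cT_0^j Q)` (same constant term) and depth
`≥ D`.  So along lost-wall moves the jet is TRANSPORTED, never recomputed, and the presentation moves by
`presentation_transport` with the same `ζ'`. -/

section JetTransport

omit [Fintype σ] in
/-- `translate` by a centre supported on `z` is the shear by the constant `b_z`. [folklore] -/
theorem translate_eq_zshear {z : σ} {b : σ → K} (hb : ∀ i, i ≠ z → b i = 0) (P : MvPolynomial σ K) :
    PointBlowup.translate b P = zshear z (C (b z)) P := by
  have hfg : (fun i => X i + C (b i) : σ → MvPolynomial σ K) = fun i => if i = z then X z + C (b z) else X i := by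
    funext i
    split_ifs with hi
    · subst hi; rfl
    · rw [hb i hi, C_0, add_zero]
  rw [NearCut.translate_eq_aeval, hfg]
  rfl

end JetTransport

end Summit.ResolutionOfSingularities.ResolutionOfSingularities.Theorems.WallFrames
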